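import Mathlib.Combinatorics.SimpleGraph.Clique
import Mathlib.Analysis.SpecialFunctions.Pow.Real
import Mathlib.Data.Nat.Log
import Literature.Combinatorics.SimpleGraph.RamseyNumbers
import Literature.Computability.Complexity.RossmanMonotoneCliqueGraphs
import Summits.PneNP.PneNP.Theses.RamseyUncertifiable

/-!
# `RamseyAbundant` — Erdős 1947 at the exact threshold `⌈2 log₂ n⌉`

Closes the support item `Summit.PneNP.PneNP.Theses.RamseyUncertifiable.RamseyAbundant`
(stmt-PneNP-9821, route `RamseyUncertifiable`): for every `n ≥ 3` some simple graph on `Fin n` has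
neither a clique nor an independent set of size `Nat.clog 2 (n ^ 2) = ⌈log₂ n²⌉`.

Proof: instantiate the tree's Erdős 1947 union bound
`Literature.Combinatorics.SimpleGraph.erdos1947_ramsey_lower_holds` (`C(n,k)·2^{1−C(k,2)} < 1 ⇒` a
graph on `n` vertices with no homogeneous `k`-set) at `k := Nat.clog 2 (n²)`, and discharge the
numerical hypothesis in integer form `2·C(n,k) < 2^{C(k,2)}`: from `n² ≤ 2^k` (`Nat.le_pow_clog`) and
`k!·C(n,k) = n(n−1)⋯(n−k+1) ≤ n^k` we get `(k!·C(n,k))² ≤ 2^{k²}`, while `2·C(k,2) + k = k²`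
(`Literature.Computability.Complexity.two_mul_choose_two_add`, reused) and
`(k!)² > 2^{k+2}` for `k ≥ 4` (`n ≥ 3 ⇒ n² > 2³ ⇒ k ≥ 4`); hence `(2·C(n,k))²·(k!)² ≤ 4·2^{k²} <
(k!)²·2^{2·C(k,2)}`.  Sources: Erdős 1947 (Bull. AMS 53), Graham–Rothschild–Spencer §4.2 Thm 1 (4).
-/

-- the namespace `Summit.PneNP.PneNP.Theorems.…` (summit = sub-problem `PneNP`) is prescribed by the tree layout
set_option linter.dupNamespace false

namespace Summit.PneNP.PneNP.Theorems

/-- `(k!)² > 2^{k+2}` for every `k ≥ 4` (at `k = 4`: `576 > 64`; the left side grows by `(k+1)² ≥ 25`,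
the right side by `2`). -/
theorem two_pow_add_two_lt_factorial_sq {k : ℕ} (hk : 4 ≤ k) :
    2 ^ (k + 2) < (Nat.factorial k) ^ 2 := by
  induction k, hk using Nat.le_induction with
  | base => decide
  | succ m hm ih =>
    rw [Nat.factorial_succ, mul_pow, show m + 1 + 2 = (m + 2) + 1 from rfl, pow_succ]
    have h25 : 25 ≤ (m + 1) ^ 2 := by nlinarith
    calc 2 ^ (m + 2) * 2 < (Nat.factorial m) ^ 2 * 25 := by omega
      _ ≤ (Nat.factorial m) ^ 2 * (m + 1) ^ 2 := Nat.mul_le_mul_left _ h25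
      _ = (m + 1) ^ 2 * (Nat.factorial m) ^ 2 := by ring

/-- The Erdős 1947 count at the threshold, integer form: if `k ≥ 4` and `n² ≤ 2^k` then
`2·C(n,k) < 2^{C(k,2)}`. -/
theorem two_mul_choose_lt_two_pow_choose_two {n k : ℕ} (hk : 4 ≤ k) (hn : n ^ 2 ≤ 2 ^ k) :
    2 * n.choose k < 2 ^ k.choose 2 := by
  -- `k!·C(n,k) ≤ n^k`, hence `(k!·C(n,k))² ≤ (n²)^k ≤ 2^{k²}`
  have h1 : Nat.factorial k * n.choose k ≤ n ^ k := by
    rw [← Nat.descFactorial_eq_factorial_mul_choose]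
    exact Nat.descFactorial_le_pow n k
  have h2 : (Nat.factorial k * n.choose k) ^ 2 ≤ 2 ^ (k * k) := by
    calc (Nat.factorial k * n.choose k) ^ 2 ≤ (n ^ k) ^ 2 := Nat.pow_le_pow_left h1 2
      _ = (n ^ 2) ^ k := by ring
      _ ≤ (2 ^ k) ^ k := Nat.pow_le_pow_left hn k
      _ = 2 ^ (k * k) := by rw [← pow_mul]
  have h3 : 2 ^ (k + 2) < (Nat.factorial k) ^ 2 := two_pow_add_two_lt_factorial_sq hk
  have h4 : 2 * k.choose 2 + k = k * k :=
    Literature.Computability.Complexity.two_mul_choose_two_add k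
  have hfpos : 0 < (Nat.factorial k) ^ 2 := by positivity
  -- compare squares: `(2·C(n,k))²·(k!)² ≤ 4·2^{k²} < (k!)²·(2^{C(k,2)})²`
  have hsq : (2 * n.choose k) ^ 2 * (Nat.factorial k) ^ 2 <
      (2 ^ k.choose 2) ^ 2 * (Nat.factorial k) ^ 2 := by
    have hkk : 2 ^ (k * k) = 2 ^ (2 * k.choose 2) * 2 ^ k := by
      rw [← pow_add, h4]
    calc (2 * n.choose k) ^ 2 * (Nat.factorial k) ^ 2
        = 4 * (Nat.factorial k * n.choose k) ^ 2 := by ring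
      _ ≤ 4 * 2 ^ (k * k) := Nat.mul_le_mul_left 4 h2
      _ = 2 ^ (2 * k.choose 2) * 2 ^ (k + 2) := by rw [hkk]; ring
      _ < 2 ^ (2 * k.choose 2) * (Nat.factorial k) ^ 2 := by gcongr
      _ = (2 ^ k.choose 2) ^ 2 * (Nat.factorial k) ^ 2 := by rw [← pow_mul, mul_comm (k.choose 2) 2]
  have hsq' : (2 * n.choose k) ^ 2 < (2 ^ k.choose 2) ^ 2 := Nat.lt_of_mul_lt_mul_right hsq
  exact (Nat.pow_lt_pow_iff_left (by norm_num)).1 hsq'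

/-- **Erdős 1947 at the exact threshold** (closes `stmt-PneNP-9821`, route `RamseyUncertifiable`,
support item `RamseyAbundant`): for every `n ≥ 3` there is a simple graph `G` on `Fin n` such that
neither `G` nor its complement `Gᶜ` contains a clique of size `Nat.clog 2 (n ^ 2) = ⌈2 log₂ n⌉` — i.e.
the language RAMSEY₂ has a member of every order `n ≥ 3`.  From
`Literature.Combinatorics.SimpleGraph.erdos1947_ramsey_lower_holds` (Erdős 1947; Graham–Rothschild–Spencer
§4.2 Thm 1 (4)) and `two_mul_choose_lt_two_pow_choose_two`. -/
theorem ramseyAbundant_proof : Summit.PneNP.PneNP.Theses.RamseyUncertifiable.RamseyAbundant := by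
  unfold Summit.PneNP.PneNP.Theses.RamseyUncertifiable.RamseyAbundant
  intro n hn
  set k := Nat.clog 2 (n ^ 2) with hk
  -- `k ≥ 4` since `2³ < 9 ≤ n²`, and `n² ≤ 2^k`
  have hk4 : 4 ≤ k := by
    have h : 3 < Nat.clog 2 (n ^ 2) := (Nat.lt_clog_iff_pow_lt one_lt_two).2 (by nlinarith)
    omega
  have hnk : n ^ 2 ≤ 2 ^ k := Nat.le_pow_clog one_lt_two (n ^ 2)
  have hint : 2 * n.choose k < 2 ^ k.choose 2 := two_mul_choose_lt_two_pow_choose_two hk4 hnk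
  refine Literature.Combinatorics.SimpleGraph.erdos1947_ramsey_lower_holds n k ?_
  -- real form of `hint`: `C(n,k) · 2^{1 − C(k,2)} = 2·C(n,k) / 2^{C(k,2)} < 1`
  have hpos : (0 : ℝ) < (2 : ℝ) ^ (k.choose 2 : ℝ) := Real.rpow_pos_of_pos two_pos _
  have h1 : (2 : ℝ) ^ ((1 : ℝ) - (k.choose 2 : ℝ)) = 2 / (2 : ℝ) ^ (k.choose 2 : ℝ) := by
    rw [Real.rpow_sub two_pos, Real.rpow_one]
  rw [h1, mul_div_assoc', div_lt_one hpos, Real.rpow_natCast]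
  have h2 : ((2 * n.choose k : ℕ) : ℝ) < ((2 ^ k.choose 2 : ℕ) : ℝ) := by exact_mod_cast hint
  push_cast at h2
  linarith

end Summit.PneNP.PneNP.Theorems
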